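import Summits.CriticalPhenomena.Ising3D.ExclusionSentencesCatalan

/-!
# Exclusion sentences — family `TRG` with all five constants `L` in kernel form
(cell `pub-ising3x`, seat recog-1)

HONEST FRAMING: lottery ticket; floor = tightest certified 3D Ising CFT bounds; no exact-solution
claim without a proof.

`ExclusionSentencesPiForms.lean` gave the kernel sentence for the `π / log 2 / e` part (`TRGπ`) of the
FAMILIES-v1 family `TRG` (`HOME/frozen/FAMILIES-v1.json`, SCOPE.md §3.1).  With the certified enclosures of
`ζ(3)`, `ζ(5)` (`ExclusionSentencesZetaValues.lean`) and `G` (`ExclusionSentencesCatalan.lean`) this file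
extends it to ALL `L ∈ {log 2, e, ζ(3), ζ(5), G}` (index `0, 1, 2, 3, 4`; indices `0, 1` agree with `lVal`,
so `trgPiFamily D h ⊆ trgFamily D h`, `trgPiFamily_subset_trgFamily`), still with `b = c = 0` — the TRG
monomials with a `Γ(¼)^b` or `Γ(⅓)^c` factor remain the only FAMILIES-v1 members outside the kernel (no
Mathlib enclosure of `Γ(¼)`, `Γ(⅓)`):
* `x = (p/q)·u·π^(a/2)·L^s`, `u ∈ {1, √2, √3}`, `a ∈ [−6, 6]`, `s ∈ {−1, 0, 1}`, `(a, s) ≠ (0, 0)`,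
  `1 ≤ p, q ≤ h`, grading `D = |a| + 2|s| + [u ≠ 1]`: `trgFamily D h`, checker `trgExcluded D h a b ex`
  (re-using `trgCandOK`, `allIntIcc`), **`trgExcluded_sound`**: every member in `[a, b]` EQUALS the value
  `trgLTupleVal e` of a listed tuple `e = (p, q, u, a, L, s)`;
* bridges `sigma_trg_covered_of_isingEnclosure`, `eps_trg_covered_of_isingEnclosure`.
Undecidable edge cases (a member within the enclosure slack — `≈ 2·10⁻¹⁰` relative for `log 2`/`e`, `10⁻¹³`
for `ζ`/`G` — of an end point) must be listed.  Kernel cost: 426 monomials × `q ≤ 32`, ≈ 2.2× `TRGπ`.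
Python twin (same enclosures and loops): `HOME/pub-ising3x-recog-1/lean/tools/trglin_exceptions.py`.
No 3D digit is used; instances live in `ExclusionSentencesControl2DZeta.lean`.
-/

namespace Summit.CriticalPhenomena.Ising3D

open Literature.MathematicalPhysics.QuantumFieldTheory.ConformalBootstrap3D

/-! ### `TRG` with `L ∈ {log 2, e, ζ(3), ζ(5), G}` -/

/-- Enclosure of `L` (index `0`: `log 2`, `2`: `ζ(3)`, `3`: `ζ(5)`, `4`: `G`, otherwise `e`). -/
def l5I : ℕ → ℚ × ℚ
  | 0 => log2I
  | 1 => eI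
  | 2 => zeta3I
  | 3 => zeta5I
  | 4 => catalanI
  | _ => eI

/-- The value `L` (index `0`: `log 2`, `2`: `ζ(3)`, `3`: `ζ(5)`, `4`: `G`, otherwise `e`; indices
`0, 1` agree with `lVal`). -/
noncomputable def l5Val : ℕ → ℝ
  | 0 => Real.log 2
  | 1 => Real.exp 1
  | 2 => zeta3
  | 3 => zeta5
  | 4 => catalan
  | _ => Real.exp 1

/-- `l5Val` extends `lVal`: they agree at the indices `0, 1` used by `trgPiFamily`. -/
theorem l5Val_of_le_one {L : ℕ} (hL : L ≤ 1) : l5Val L = lVal L := by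
  interval_cases L <;> rfl

/-- Soundness of `l5I`, and positivity of both ends. -/
theorem l5Val_mem (L : ℕ) : l5Val L ∈ InI (l5I L) ∧ 0 < (l5I L).1 ∧ 0 < (l5I L).2 := by
  match L with
  | 0 => exact ⟨log2_mem_log2I, by norm_num [l5I, log2I], by norm_num [l5I, log2I]⟩
  | 1 => exact ⟨e_mem_eI, by norm_num [l5I, eI], by norm_num [l5I, eI]⟩
  | 2 => exact ⟨zeta3_mem_zeta3I, by norm_num [l5I, zeta3I], by norm_num [l5I, zeta3I]⟩
  | 3 => exact ⟨zeta5_mem_zeta5I, by norm_num [l5I, zeta5I], by norm_num [l5I, zeta5I]⟩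
  | 4 => exact ⟨catalan_mem_catalanI, by norm_num [l5I, catalanI], by norm_num [l5I, catalanI]⟩
  | n + 5 =>
      exact ⟨e_mem_eI, by show (0 : ℚ) < eI.1; norm_num [eI], by show (0 : ℚ) < eI.2; norm_num [eI]⟩

/-- The TRG monomial `u · (√π)^a · L^s` with `L` from the full list. -/
noncomputable def trgLVal (u : ℕ) (a : ℤ) (L : ℕ) (s : ℤ) : ℝ :=
  uVal u * Real.sqrt Real.pi ^ a * l5Val L ^ s

/-- Rational enclosure of `trgLVal u a L s`. -/
def trgLEncl (u : ℕ) (a : ℤ) (L : ℕ) (s : ℤ) : ℚ × ℚ :=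
  mulI (mulI (uI u) (zpowI sqrtPiI a)) (zpowI (l5I L) s)

/-- Soundness of `trgLEncl`, and positivity of its lower end. -/
theorem trgLVal_mem (u : ℕ) (a : ℤ) (L : ℕ) (s : ℤ) :
    trgLVal u a L s ∈ InI (trgLEncl u a L s) ∧ 0 < (trgLEncl u a L s).1 := by
  obtain ⟨hu, hu0⟩ := uVal_mem u
  obtain ⟨hl, hl1, hl2⟩ := l5Val_mem L
  have hsp : 0 < sqrtPiI.1 := by norm_num [sqrtPiI]
  have hsp2 : 0 < sqrtPiI.2 := by norm_num [sqrtPiI]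
  have h1 := zpowI_sound hsp sqrtPi_mem_sqrtPiI a
  have h1p := zpowI_pos hsp hsp2 a
  have h2 := zpowI_sound hl1 hl s
  have h2p := zpowI_pos hl1 hl2 s
  refine ⟨mulI_sound (by simp only [mulI]; positivity) h2p.le (mulI_sound hu0.le h1p.le hu h1) h2, ?_⟩
  simp only [trgLEncl, mulI]
  positivity

/-- `trgFamily D h` = the TRG members with no `Γ` factor: `(p/q) · u · π^(a/2) · L^s`, `1 ≤ p, q ≤ h`,
`u ∈ {1, √2, √3}` (index `≤ 2`), `a ∈ [−6, 6]`, `L ∈ {log 2, e, ζ(3), ζ(5), G}` (index `≤ 4`),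
`s ∈ [−1, 1]`, `(a, s) ≠ (0, 0)`, complexity `|a| + 2|s| + [u ≠ 1] ≤ D` (FAMILIES-v1 TRG with
`b = c = 0`; `p/q` need not be reduced — a superset). -/
def trgFamily (D h : ℕ) : Set ℝ :=
  {x | ∃ (p q u L : ℕ) (a s : ℤ), 1 ≤ p ∧ p ≤ h ∧ 1 ≤ q ∧ q ≤ h ∧ u ≤ 2 ∧ L ≤ 4 ∧ -6 ≤ a ∧ a ≤ 6 ∧
    -1 ≤ s ∧ s ≤ 1 ∧ (a ≠ 0 ∨ s ≠ 0) ∧ a.natAbs + 2 * s.natAbs + (if u = 0 then 0 else 1) ≤ D ∧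
    x = (p : ℝ) / q * trgLVal u a L s}

/-- The `π`-forms are a sub-family: `trgPiFamily D h ⊆ trgFamily D h`. -/
theorem trgPiFamily_subset_trgFamily (D h : ℕ) : trgPiFamily D h ⊆ trgFamily D h := by
  rintro x ⟨p, q, u, L, a, s, hp1, hph, hq1, hqh, hu, hL, ha1, ha2, hs1, hs2, hne, hD, rfl⟩
  refine ⟨p, q, u, L, a, s, hp1, hph, hq1, hqh, hu, by omega, ha1, ha2, hs1, hs2, hne, hD, ?_⟩
  simp only [trgLVal, trgVal, l5Val_of_le_one hL]

/-- A listed TRG tuple `(p, q, u, a, L, s)` and its value (full `L` list). -/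
noncomputable def trgLTupleVal (e : ℕ × ℕ × ℕ × ℤ × ℕ × ℤ) : ℝ :=
  (e.1 : ℝ) / e.2.1 * trgLVal e.2.2.1 e.2.2.2.1 e.2.2.2.2.1 e.2.2.2.2.2

/-- The TRG checker over the full `L` list: as `trgPiExcluded` with `L ≤ 4` (the duplicate monomials
`L ≠ 0, s = 0` are skipped — normalised to `L = 0`). -/
def trgExcluded (D h : ℕ) (a b : ℚ) (ex : List (ℕ × ℕ × ℕ × ℤ × ℕ × ℤ)) : Bool :=
  (List.range 3).all fun u =>
    allIntIcc (-6) 6 fun av =>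
      (List.range 5).all fun L =>
        allIntIcc (-1) 1 fun s =>
          decide (av = 0 ∧ s = 0) || decide (s = 0 ∧ 0 < L) ||
            !decide (av.natAbs + 2 * s.natAbs + (if u = 0 then 0 else 1) ≤ D) ||
            (List.range' 1 h).all fun q =>
              allIntIcc (max 1 ⌈a * q / (trgLEncl u av L s).2⌉)
                (min (h : ℤ) ⌊b * q / (trgLEncl u av L s).1⌋)
                (trgCandOK a b ex u av L s (trgLEncl u av L s) q)

/-- **Soundness of the TRG sentence.** If `trgExcluded D h a b ex = true` then every member of
`trgFamily D h` in `[a, b]` equals the value of a listed tuple. -/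
theorem trgExcluded_sound {D h : ℕ} {a b : ℚ} {ex : List (ℕ × ℕ × ℕ × ℤ × ℕ × ℤ)}
    (hc : trgExcluded D h a b ex = true) {x : ℝ} (hx : (a : ℝ) ≤ x ∧ x ≤ b)
    (hmem : x ∈ trgFamily D h) : ∃ e ∈ ex, x = trgLTupleVal e := by
  obtain ⟨p, q, u, L₀, av, s, hp1, hph, hq1, hqh, hu, hL₀, ha1, ha2, hs1, hs2, hne, hD, rfl⟩ := hmem
  -- when `s = 0` the constant `L` plays no role: normalise to `L = 0` (the checker skips the duplicates)
  obtain ⟨L, hL, hskip, hval⟩ : ∃ L, L ≤ 4 ∧ ¬(s = 0 ∧ 0 < L) ∧ trgLVal u av L₀ s = trgLVal u av L s := by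
    by_cases hs : s = 0
    · exact ⟨0, by omega, by omega, by simp [trgLVal, hs]⟩
    · exact ⟨L₀, hL₀, by omega, rfl⟩
  rw [hval] at hx ⊢
  obtain ⟨⟨hm1, hm2⟩, hm0⟩ := trgLVal_mem u av L s
  set m := trgLEncl u av L s with hm
  have hm0' : (0 : ℝ) < m.1 := by exact_mod_cast hm0
  have hq0 : (0 : ℝ) < q := by exact_mod_cast hq1
  have hpq0 : (0 : ℝ) < (p : ℝ) / q := by positivity
  unfold trgExcluded at hc
  have h1 := List.all_eq_true.mp hc u (List.mem_range.mpr (by omega))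
  have h2 := allIntIcc_sound h1 ha1 ha2
  have h3 := List.all_eq_true.mp h2 L (List.mem_range.mpr (by omega))
  have h4 := allIntIcc_sound h3 hs1 hs2
  simp only [Bool.or_eq_true, decide_eq_true_eq, Bool.not_eq_true', decide_eq_false_iff_not] at h4
  rcases h4 with ((h4 | h4) | h4) | h4
  · omega
  · exact absurd h4 hskip
  · exact absurd hD h4
  · have h5 := List.all_eq_true.mp h4 q (List.mem_range'_1.mpr ⟨hq1, by omega⟩)
    have hlo : max 1 ⌈a * q / m.2⌉ ≤ (p : ℤ) := by
      refine max_le (by exact_mod_cast hp1) ?_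
      have hm2q : (0 : ℚ) < m.2 := by
        have : (m.1 : ℝ) ≤ m.2 := hm1.trans hm2
        exact lt_of_lt_of_le hm0 (by exact_mod_cast this)
      rw [Int.ceil_le, div_le_iff₀ hm2q]
      have : (a : ℝ) * q ≤ p * m.2 := by
        have h' : (p : ℝ) / q * trgLVal u av L s ≤ p / q * m.2 := mul_le_mul_of_nonneg_left hm2 hpq0.le
        have h'' : (a : ℝ) ≤ p / q * m.2 := hx.1.trans h'
        calc (a : ℝ) * q ≤ p / q * m.2 * q := mul_le_mul_of_nonneg_right h'' hq0.le
          _ = p * m.2 := by field_simp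
      exact_mod_cast this
    have hhi : (p : ℤ) ≤ min (h : ℤ) ⌊b * q / m.1⌋ := by
      refine le_min (by exact_mod_cast hph) ?_
      rw [Int.le_floor, le_div_iff₀ hm0]
      have : (p : ℝ) * m.1 ≤ b * q := by
        have h' : (p : ℝ) / q * m.1 ≤ p / q * trgLVal u av L s := mul_le_mul_of_nonneg_left hm1 hpq0.le
        have h'' : (p : ℝ) / q * m.1 ≤ b := h'.trans hx.2
        calc (p : ℝ) * m.1 = p / q * m.1 * q := by field_simp
          _ ≤ b * q := mul_le_mul_of_nonneg_right h'' hq0.le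
      exact_mod_cast this
    have h6 := allIntIcc_sound h5 hlo hhi
    unfold trgCandOK at h6
    simp only [Bool.or_eq_true, decide_eq_true_eq, List.any_eq_true] at h6
    rcases h6 with (h6 | h6) | ⟨e, he, hkey⟩
    · exfalso
      have h7 : (((p : ℚ) / q * m.2 : ℚ) : ℝ) < (a : ℝ) := Rat.cast_lt.mpr h6
      push_cast at h7
      linarith [mul_le_mul_of_nonneg_left hm2 hpq0.le, hx.1]
    · exfalso
      have h7 : ((b : ℚ) : ℝ) < (((p : ℚ) / q * m.1 : ℚ) : ℝ) := Rat.cast_lt.mpr h6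
      push_cast at h7
      linarith [mul_le_mul_of_nonneg_left hm1 hpq0.le, hx.2]
    · obtain ⟨he0, heu, hea, heL, hes, hpq⟩ := hkey
      refine ⟨e, he, ?_⟩
      unfold trgLTupleVal
      rw [heu, hea, heL, hes]
      have he2 : (0 : ℝ) < e.2.1 := by exact_mod_cast he0
      have hpq' : (p : ℝ) * e.2.1 = e.1 * q := by exact_mod_cast hpq
      congr 1
      rw [div_eq_div_iff hq0.ne' he2.ne']
      exact hpq'

/-! ### Bridges from the floor's statements -/

/-- **TRG sentence for `Δ_σ`.** Under `IsingEnclosure W R` with the `Δ_σ`-projection of `R` in `[a, b]`: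
if `Δ_σ` is a `Γ`-free TRG form of the stated bounds, it equals a listed tuple's value. -/
theorem sigma_trg_covered_of_isingEnclosure {W R : Set (ℝ × ℝ)} (h : IsingEnclosure W R) {a b : ℚ}
    (hR : ∀ q ∈ R, (a : ℝ) ≤ q.1 ∧ q.1 ≤ b) {Dm hh : ℕ} {ex : List (ℕ × ℕ × ℕ × ℤ × ℕ × ℤ)}
    (hx : trgExcluded Dm hh a b ex = true) (D : SigmaEpsilonData) (hD : D.SatisfiesBootstrapAxioms)
    (hW : (D.Δσ, D.Δε) ∈ W) (hmem : D.Δσ ∈ trgFamily Dm hh) : ∃ e ∈ ex, D.Δσ = trgLTupleVal e :=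
  trgExcluded_sound hx (hR _ (h D hD hW)) hmem

/-- **TRG sentence for `Δ_ε`.** -/
theorem eps_trg_covered_of_isingEnclosure {W R : Set (ℝ × ℝ)} (h : IsingEnclosure W R) {a b : ℚ}
    (hR : ∀ q ∈ R, (a : ℝ) ≤ q.2 ∧ q.2 ≤ b) {Dm hh : ℕ} {ex : List (ℕ × ℕ × ℕ × ℤ × ℕ × ℤ)}
    (hx : trgExcluded Dm hh a b ex = true) (D : SigmaEpsilonData) (hD : D.SatisfiesBootstrapAxioms)
    (hW : (D.Δσ, D.Δε) ∈ W) (hmem : D.Δε ∈ trgFamily Dm hh) : ∃ e ∈ ex, D.Δε = trgLTupleVal e :=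
  trgExcluded_sound hx (hR _ (h D hD hW)) hmem

end Summit.CriticalPhenomena.Ising3D
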